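import Summits.KontsevichZagierPeriods.KontsevichZagierPeriods.Theorems.SymplecticScissorsVolumeFormOffPlaneAffineOrbitPairs
import Summits.KontsevichZagierPeriods.KontsevichZagierPeriods.Theorems.SymplecticScissorsVolumeFormOffPlaneEuclideanCornerCut
import Summits.KontsevichZagierPeriods.KontsevichZagierPeriods.Theorems.HyperbolicBlochOffTetraSectorKernelPolytopeImageSimilarity
import Literature.NumberTheory.Transcendental.EllIterRep

/-!
# `VolumeFormOffPlane` (stmt-KontsevichZagierPeriods-14935) — line `Sketch`,
stub `stub_algebraicBevelledBoxPairs` (pairs of algebraic bevelled boxes: the Euclidean twin of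
`stub_bevelledBoxPairs`)

An *algebraic bevelled box* in `ℝᵈ` is an open box `{∀ ι, a ι < x ι < b ι}` with real algebraic
corners `a ≤ b` cut by one affine half-space `∑ ι, m ι * x ι < c` with real algebraic `m ι > 0`
and `c`.  Two integrand-`1` representations on algebraic bevelled boxes with the same value are
KZ-equivalent.

Proof (bookkeeping over landed siblings): `algebraicSimplexPairs` (…AffineOrbitPairs.lean,
transported to the finite index type `Finset (Fin d)`, `abbp_pairsFintype`) fed, for each of
the two boxes, with (`abbp_side`)
* the integrand-`1` representations `ρ S` on the `2ᵈ` CORNER PIECES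
  `P_S = {∀ ι, e_S ι < y ι} ∩ {∑ ι, m ι * y ι < c}` (`e_S = b` on `S`, `a` off `S`), which exist by
  `KZ.exists_oneRep` (`P_S` is `ℚ`-semialgebraic — affine inequalities with real algebraic
  constants, `abbp_isSemialgebraic_piece` — and sits in a compact box, `abbp_piece_subset_Icc`);
* the weights `w S = (-1)^{#S}` if `λ_S = c − ∑ ι, m ι * e_S ι > 0` and `w S = 0` otherwise
  (then `P_S = ∅`, `abbp_not_mem_piece`);
* for `w S ≠ 0` the affine datum: `P_S = D_S Δ_d + e_S` with the diagonal matrix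
  `D_S = diag (λ_S / m ι)` (real algebraic entries, `det D_S = ∏ λ_S / m ι ≠ 0`) and the open
  corner simplex `Δ_d = {u > 0, ∑ u < 1}` (`abbp_piece_eq_image`);
* the a.e. signed decomposition `1_r = ∑_S w S · 1_{ρ S}`: off the null walls `{x ι = b ι}`
  (`abbp_ae_ne`) this is the Euclidean corner-cut identity `stub_euclideanCornerCut`
  (inclusion–exclusion of translated orthants), the empty pieces being dropped.

Sources: M. Kontsevich, D. Zagier, *Periods* (2001), §1.2 (rules (1), (2)); the bookkeeping
(inclusion–exclusion over corner pieces, a cut orthant is a dilated simplex) is folklore.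
-/

noncomputable section

open MeasureTheory Set
open Literature.NumberTheory.Transcendental
open Literature.ModelTheory.ExponentialFields (IsSemialgebraic)
open Summit.KontsevichZagierPeriods.HyperbolicBloch.OffTetraSectorKernel (polySimil_isAlgebraic_sum)

namespace Summit.KontsevichZagierPeriods.SymplecticScissors.LogPolytope

/-! ## Bookkeeping: null walls -/

/-- Almost every point of `ℝᵈ` lies off the finitely many coordinate hyperplanes `{x ι = b ι}`
(each is Lebesgue-null). [folklore] -/
theorem abbp_ae_ne {d : ℕ} (b : Fin d → ℝ) : ∀ᵐ x : Fin d → ℝ, ∀ ι, x ι ≠ b ι := by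
  -- adapted from `cbd_ae_castSucc_ne` (…CutBoxDecomposition.lean)
  rw [ae_all_iff]
  intro ι
  rw [volume_pi]
  exact Measure.ae_eval_ne _ _ _

/-! ## Corner pieces: semialgebraic, bounded, empty or a dilated simplex -/

/-- An open affine half-space `{y | ∑ ι, w ι * y ι < k}` with real algebraic `w`, `k` is
`ℚ`-semialgebraic (the negativity set of the `ℚ`-semialgebraic function `∑ w y − k`).
[folklore] -/
theorem abbp_isSemialgebraic_halfspace {d : ℕ} {w : Fin d → ℝ} {k : ℝ}
    (hw : ∀ ι, IsAlgebraic ℚ (w ι)) (hk : IsAlgebraic ℚ k) :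
    IsSemialgebraic ℚ {y : Fin d → ℝ | ∑ ι, w ι * y ι < k} := by
  -- adapted from `aff_orbit_isSemialgebraicMapOn` (…OffTetraSectorKernelStubAffineOrbit.lean)
  have hU : IsSemialgebraic ℚ (univ : Set (Fin d → ℝ)) :=
    Literature.ModelTheory.ExponentialFields.isSemialgebraic_univ
  have hcoord : ∀ ι : Fin d, IsSemialgebraicFunOn ℚ (univ : Set (Fin d → ℝ)) (fun y => y ι) :=
    fun ι => by
    simpa using isSemialgebraicFunOn_aeval hU (MvPolynomial.X ι : MvPolynomial (Fin d) ℚ)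
  have hsum : IsSemialgebraicFunOn ℚ (univ : Set (Fin d → ℝ)) (fun y => ∑ ι, w ι * y ι) :=
    KZ.isSemialgebraicFunOn_finset_sum Finset.univ hU fun ι _ =>
      (IsSemialgebraicFunOn.mul_holds (isSemialgebraicFunOn_const_of_isAlgebraic hU (hw ι))
        (hcoord ι)).congr fun y _ => rfl
  have h : IsSemialgebraicFunOn ℚ (univ : Set (Fin d → ℝ)) (fun y => ∑ ι, w ι * y ι - k) :=
    (IsSemialgebraicFunOn.sub_holds hsum (isSemialgebraicFunOn_const_of_isAlgebraic hU hk)).congr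
      fun y _ => rfl
  convert h.isSemialgebraic_sep_neg using 1
  ext y
  simp [sub_neg]

/-- A corner piece `{e < y, ∑ m y < c}` with real algebraic `e`, `m`, `c` is `ℚ`-semialgebraic.
[folklore] -/
theorem abbp_isSemialgebraic_piece {d : ℕ} {e m : Fin d → ℝ} {c : ℝ}
    (hea : ∀ ι, IsAlgebraic ℚ (e ι)) (hma : ∀ ι, IsAlgebraic ℚ (m ι)) (hca : IsAlgebraic ℚ c) :
    IsSemialgebraic ℚ {y : Fin d → ℝ | (∀ ι, e ι < y ι) ∧ ∑ ι, m ι * y ι < c} := by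
  have hbox : IsSemialgebraic ℚ (⋂ ι ∈ (Finset.univ : Finset (Fin d)),
      {y : Fin d → ℝ | e ι < y ι}) :=
    Literature.ModelTheory.ExponentialFields.IsSemialgebraic.biInter _ _ fun ι _ =>
      KZ.isSemialgebraic_setOf_const_lt_apply (hea ι) ι
  have hset : {y : Fin d → ℝ | (∀ ι, e ι < y ι) ∧ ∑ ι, m ι * y ι < c} =
      (⋂ ι ∈ (Finset.univ : Finset (Fin d)), {y : Fin d → ℝ | e ι < y ι}) ∩
        {y : Fin d → ℝ | ∑ ι, m ι * y ι < c} := by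
    ext y
    simp
  rw [hset]
  exact hbox.inter (abbp_isSemialgebraic_halfspace hma hca)

/-- A corner piece `{e < y, ∑ m y < c}` (`m > 0`) lies in the compact box
`[e, e + λ / m]`, `λ = c − ∑ m e`: `m ι (y ι − e ι) ≤ ∑ κ, m κ (y κ − e κ) < λ`. [folklore] -/
theorem abbp_piece_subset_Icc {d : ℕ} (e m : Fin d → ℝ) (c : ℝ) (hm : ∀ ι, 0 < m ι) :
    {y : Fin d → ℝ | (∀ ι, e ι < y ι) ∧ ∑ ι, m ι * y ι < c} ⊆
      Icc e (fun ι => e ι + (c - ∑ κ, m κ * e κ) / m ι) := by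
  rintro y ⟨he, hc⟩
  refine ⟨fun ι => (he ι).le, fun ι => ?_⟩
  have hsingle : m ι * (y ι - e ι) ≤ ∑ κ, m κ * (y κ - e κ) :=
    Finset.single_le_sum (f := fun κ => m κ * (y κ - e κ))
      (fun κ _ => mul_nonneg (hm κ).le (sub_nonneg.mpr (he κ).le)) (Finset.mem_univ ι)
  have hsum : ∑ κ, m κ * (y κ - e κ) = ∑ κ, m κ * y κ - ∑ κ, m κ * e κ := by
    simp only [mul_sub, Finset.sum_sub_distrib]
  have hlt : y ι - e ι < (c - ∑ κ, m κ * e κ) / m ι := by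
    rw [lt_div_iff₀ (hm ι)]
    linarith
  show y ι ≤ e ι + (c - ∑ κ, m κ * e κ) / m ι
  linarith

/-- A corner piece `{e < y, ∑ m y < c}` (`m > 0`) with `λ = c − ∑ m e ≤ 0` is empty: on it
`∑ m e ≤ ∑ m y < c`. [folklore] -/
theorem abbp_not_mem_piece {d : ℕ} {e m : Fin d → ℝ} {c : ℝ} (hm : ∀ ι, 0 < m ι)
    (hle : ¬ 0 < c - ∑ κ, m κ * e κ) (y : Fin d → ℝ) :
    y ∉ {y : Fin d → ℝ | (∀ ι, e ι < y ι) ∧ ∑ ι, m ι * y ι < c} := by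
  rintro ⟨he, hc⟩
  have h : ∑ κ, m κ * e κ ≤ ∑ κ, m κ * y κ :=
    Finset.sum_le_sum fun κ _ => mul_le_mul_of_nonneg_left (he κ).le (hm κ).le
  exact hle (by linarith)

/-- A non-empty corner piece is a dilated open corner simplex:
`{e < y, ∑ m y < c} = diag (λ / m) Δ_d + e` for `λ = c − ∑ m e > 0`, `m > 0`
(`y = e + (λ / m) u ↔ u = m (y − e) / λ`). [folklore] -/
theorem abbp_piece_eq_image {d : ℕ} (e m : Fin d → ℝ) (c : ℝ) (hm : ∀ ι, 0 < m ι)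
    (hL : 0 < c - ∑ κ, m κ * e κ) :
    {y : Fin d → ℝ | (∀ ι, e ι < y ι) ∧ ∑ ι, m ι * y ι < c} =
      (fun u => (Matrix.diagonal fun ι => (c - ∑ κ, m κ * e κ) / m ι).mulVec u + e) ''
        {u : Fin d → ℝ | (∀ i, 0 < u i) ∧ ∑ i, u i < 1} := by
  ext y
  constructor
  · rintro ⟨he, hc⟩
    refine ⟨fun ι => m ι * (y ι - e ι) / (c - ∑ κ, m κ * e κ),
      ⟨fun ι => div_pos (mul_pos (hm ι) (sub_pos.mpr (he ι))) hL, ?_⟩, ?_⟩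
    · rw [← Finset.sum_div, div_lt_one hL]
      simp only [mul_sub, Finset.sum_sub_distrib]
      linarith
    · funext ι
      have hmi : m ι ≠ 0 := (hm ι).ne'
      have hLne : (c - ∑ κ, m κ * e κ) ≠ 0 := hL.ne'
      simp only [Pi.add_apply, Matrix.mulVec_diagonal]
      field_simp
      ring
  · rintro ⟨u, ⟨hu0, hu1⟩, rfl⟩
    refine ⟨fun ι => ?_, ?_⟩
    · simp only [Pi.add_apply, Matrix.mulVec_diagonal]
      have : 0 < (c - ∑ κ, m κ * e κ) / m ι * u ι := mul_pos (div_pos hL (hm ι)) (hu0 ι)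
      linarith
    · simp only [Pi.add_apply, Matrix.mulVec_diagonal]
      have h : ∀ ι, m ι * ((c - ∑ κ, m κ * e κ) / m ι * u ι + e ι) =
          (c - ∑ κ, m κ * e κ) * u ι + m ι * e ι := fun ι => by
        have hmi : m ι ≠ 0 := (hm ι).ne'
        field_simp
      simp only [h, Finset.sum_add_distrib, ← Finset.mul_sum]
      have := mul_lt_mul_of_pos_left hu1 hL
      linarith [mul_one (c - ∑ κ, m κ * e κ)]

/-! ## One algebraic bevelled box: corner representations, affine data, decomposition -/

/-- **One algebraic bevelled box.** For an algebraic bevelled box `r` there are integrand-`1`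
representations `ρ S` on its `2ᵈ` corner pieces
(`S ⊆ Fin d`) and weights `w S ∈ {0, (-1)^{#S}}` (zero exactly on the empty pieces) such that
every piece of non-zero weight is a real-algebraic non-degenerate affine image of the open
corner simplex and `1_r = ∑_S w S · 1_{ρ S}` almost everywhere (`stub_euclideanCornerCut` off
the null walls). [folklore] -/
theorem abbp_side {d : ℕ} (a b m : Fin d → ℝ) (c : ℝ) (r : KZ.IntegralRep d)
    (haa : ∀ ι, IsAlgebraic ℚ (a ι)) (hba : ∀ ι, IsAlgebraic ℚ (b ι))
    (hma : ∀ ι, IsAlgebraic ℚ (m ι)) (hca : IsAlgebraic ℚ c) (hab : ∀ ι, a ι ≤ b ι)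
    (hm : ∀ ι, 0 < m ι)
    (hr : r.domain = {x : Fin d → ℝ | (∀ ι, a ι < x ι ∧ x ι < b ι) ∧ ∑ ι, m ι * x ι < c}) :
    ∃ (ρ : Finset (Fin d) → KZ.IntegralRep d) (w : Finset (Fin d) → ℤ),
      (∀ S, ∀ x ∈ (ρ S).domain, (ρ S).integrand x = 1) ∧
      (∀ S, w S ≠ 0 → ∃ (A : Matrix (Fin d) (Fin d) ℝ) (v : Fin d → ℝ),
        (∀ j l, IsAlgebraic ℚ (A j l)) ∧ (∀ j, IsAlgebraic ℚ (v j)) ∧ A.det ≠ 0 ∧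
        (ρ S).domain = (fun x => A.mulVec x + v) ''
          {x : Fin d → ℝ | (∀ i, 0 < x i) ∧ ∑ i, x i < 1}) ∧
      (∀ᵐ x : Fin d → ℝ, r.domain.indicator (fun _ => (1 : ℝ)) x =
        ∑ S, (w S : ℝ) * (ρ S).domain.indicator (fun _ => (1 : ℝ)) x) := by
  classical
  -- the corners `e_S` are real algebraic, and so are the slacks `λ_S = c - ∑ m e_S`
  have hea : ∀ (S : Finset (Fin d)) ι, IsAlgebraic ℚ (if ι ∈ S then b ι else a ι) :=
    fun S ι => by
    split_ifs
    · exact hba ι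
    · exact haa ι
  have hLa : ∀ S : Finset (Fin d),
      IsAlgebraic ℚ (c - ∑ κ, m κ * (if κ ∈ S then b κ else a κ)) := fun S =>
    hca.sub (polySimil_isAlgebraic_sum _ _ fun κ _ => (hma κ).mul (hea S κ))
  -- the corner representations
  have hex : ∀ S : Finset (Fin d), ∃ ρS : KZ.IntegralRep d,
      ρS.domain = {y : Fin d → ℝ | (∀ ι, (if ι ∈ S then b ι else a ι) < y ι) ∧
        ∑ ι, m ι * y ι < c} ∧ ρS.integrand = fun _ => 1 := fun S =>
    KZ.exists_oneRep (abbp_isSemialgebraic_piece (hea S) hma hca)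
      (((measure_mono (abbp_piece_subset_Icc (fun ι => if ι ∈ S then b ι else a ι) m c
        hm)).trans_lt isCompact_Icc.measure_lt_top).ne)
  choose ρ hρd hρi using hex
  refine ⟨ρ, fun S => if 0 < c - ∑ κ, m κ * (if κ ∈ S then b κ else a κ) then (-1) ^ S.card
    else 0, fun S x _ => by rw [hρi S], fun S hS => ?_, ?_⟩
  · -- affine data of a non-empty piece
    have hLS : 0 < c - ∑ κ, m κ * (if κ ∈ S then b κ else a κ) := by
      by_contra h
      exact hS (if_neg h)
    refine ⟨Matrix.diagonal fun ι => (c - ∑ κ, m κ * (if κ ∈ S then b κ else a κ)) / m ι,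
      fun ι => if ι ∈ S then b ι else a ι, fun j l => ?_, hea S, ?_, ?_⟩
    · rw [Matrix.diagonal_apply]
      split_ifs
      · rw [div_eq_mul_inv]
        exact (hLa S).mul (hma j).inv
      · exact isAlgebraic_zero
    · rw [Matrix.det_diagonal]
      exact Finset.prod_ne_zero_iff.mpr fun ι _ => div_ne_zero hLS.ne' (hm ι).ne'
    · rw [hρd S]
      exact abbp_piece_eq_image (fun ι => if ι ∈ S then b ι else a ι) m c hm hLS
  · -- the a.e. decomposition, empty pieces dropped
    filter_upwards [abbp_ae_ne b] with x hx
    rw [hr, stub_euclideanCornerCut d a b m c x hab hx]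
    refine Finset.sum_congr rfl fun S _ => ?_
    rw [hρd S]
    by_cases hLS : 0 < c - ∑ κ, m κ * (if κ ∈ S then b κ else a κ)
    · rw [if_pos hLS]
      push_cast
      rfl
    · rw [if_neg hLS, Int.cast_zero, zero_mul,
        Set.indicator_of_notMem (abbp_not_mem_piece hm hLS x), mul_zero]

/-! ## The index transport and the stub -/

/-- `algebraicSimplexPairs` over arbitrary finite index types (reindex by `Fintype.equivFin`).
[folklore] -/
theorem abbp_pairsFintype :
    ∀ (d : ℕ) (ι ι' : Type) [Fintype ι] [Fintype ι'] (r r' : KZ.IntegralRep d)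
        (ρ : ι → KZ.IntegralRep d) (ρ' : ι' → KZ.IntegralRep d) (c : ι → ℤ) (c' : ι' → ℤ),
      (∀ x ∈ r.domain, r.integrand x = 1) → (∀ x ∈ r'.domain, r'.integrand x = 1) →
      (∀ i, ∀ x ∈ (ρ i).domain, (ρ i).integrand x = 1) →
      (∀ i, ∀ x ∈ (ρ' i).domain, (ρ' i).integrand x = 1) →
      (∀ i, c i ≠ 0 → ∃ (A : Matrix (Fin d) (Fin d) ℝ) (b : Fin d → ℝ),
        (∀ j l, IsAlgebraic ℚ (A j l)) ∧ (∀ j, IsAlgebraic ℚ (b j)) ∧ A.det ≠ 0 ∧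
        (ρ i).domain = (fun x => A.mulVec x + b) ''
          {x : Fin d → ℝ | (∀ i, 0 < x i) ∧ ∑ i, x i < 1}) →
      (∀ i, c' i ≠ 0 → ∃ (A : Matrix (Fin d) (Fin d) ℝ) (b : Fin d → ℝ),
        (∀ j l, IsAlgebraic ℚ (A j l)) ∧ (∀ j, IsAlgebraic ℚ (b j)) ∧ A.det ≠ 0 ∧
        (ρ' i).domain = (fun x => A.mulVec x + b) ''
          {x : Fin d → ℝ | (∀ i, 0 < x i) ∧ ∑ i, x i < 1}) →
      (∀ᵐ x : Fin d → ℝ, r.domain.indicator (fun _ => (1 : ℝ)) x =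
        ∑ i, (c i : ℝ) * (ρ i).domain.indicator (fun _ => (1 : ℝ)) x) →
      (∀ᵐ x : Fin d → ℝ, r'.domain.indicator (fun _ => (1 : ℝ)) x =
        ∑ i, (c' i : ℝ) * (ρ' i).domain.indicator (fun _ => (1 : ℝ)) x) →
      r.value = r'.value → KZ.Equivalent r r' := by
  -- adapted from `certifiedPairsFintype` (…CertifiedPairs.lean)
  intro d ι ι' _ _ r r' ρ ρ' c c' hr hr' hρ hρ' hc hc' hdec hdec' hval
  classical
  set e := Fintype.equivFin ι with he
  set e' := Fintype.equivFin ι' with he'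
  refine algebraicSimplexPairs d r r' (Fintype.card ι) (Fintype.card ι')
    (fun i => ρ (e.symm i)) (fun i => ρ' (e'.symm i)) (fun i => c (e.symm i))
    (fun i => c' (e'.symm i)) hr hr'
    (fun i => hρ (e.symm i)) (fun i => hρ' (e'.symm i)) (fun i hi => hc (e.symm i) hi)
    (fun i hi => hc' (e'.symm i) hi) ?_ ?_ hval
  · filter_upwards [hdec] with x hx
    rw [hx]
    exact (e.symm.sum_comp (fun i => (c i : ℝ) * (ρ i).domain.indicator (fun _ => (1 : ℝ)) x)).symm
  · filter_upwards [hdec'] with x hx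
    rw [hx]
    exact (e'.symm.sum_comp
      (fun i => (c' i : ℝ) * (ρ' i).domain.indicator (fun _ => (1 : ℝ)) x)).symm

/-- **Stub (ALGEBRAIC BEVELLED-BOX PAIRS).** Two integrand-`1` representations on algebraic
bevelled boxes `{∀ ι, a ι < x ι < b ι} ∩ {∑ ι, m ι * x ι < c}` (real algebraic corners `a ≤ b`,
real algebraic `m > 0` and `c`) with equal value are KZ-equivalent: `algebraicSimplexPairs` over
the index type `Finset (Fin d)` (`abbp_pairsFintype`) with the weights, corner representations,
affine data and a.e. decompositions of `abbp_side`. Volume is the only obstruction.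
[folklore] -/
theorem stub_algebraicBevelledBoxPairs : ∀ (d : ℕ) (a b m : Fin d → ℝ) (c : ℝ) (a' b' m' : Fin d → ℝ) (c' : ℝ) (r r' : KZ.IntegralRep d),
    (∀ ι, IsAlgebraic ℚ (a ι)) → (∀ ι, IsAlgebraic ℚ (b ι)) → (∀ ι, IsAlgebraic ℚ (m ι)) → IsAlgebraic ℚ c →
    (∀ ι, a ι ≤ b ι) → (∀ ι, 0 < m ι) →
    (∀ ι, IsAlgebraic ℚ (a' ι)) → (∀ ι, IsAlgebraic ℚ (b' ι)) → (∀ ι, IsAlgebraic ℚ (m' ι)) → IsAlgebraic ℚ c' →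
    (∀ ι, a' ι ≤ b' ι) → (∀ ι, 0 < m' ι) →
    r.domain = {x : Fin d → ℝ | (∀ ι, a ι < x ι ∧ x ι < b ι) ∧ ∑ ι, m ι * x ι < c} →
    r'.domain = {x : Fin d → ℝ | (∀ ι, a' ι < x ι ∧ x ι < b' ι) ∧ ∑ ι, m' ι * x ι < c'} →
    (∀ x ∈ r.domain, r.integrand x = 1) → (∀ x ∈ r'.domain, r'.integrand x = 1) →
    r.value = r'.value → KZ.Equivalent r r' := by
  intro d a b m c a' b' m' c' r r' haa hba hma hca hab hm haa' hba' hma' hca' hab' hm' hr hr'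
    h1 h1' hval
  obtain ⟨ρ, w, hρi, hcert, hdec⟩ := abbp_side a b m c r haa hba hma hca hab hm hr
  obtain ⟨ρ', w', hρi', hcert', hdec'⟩ :=
    abbp_side a' b' m' c' r' haa' hba' hma' hca' hab' hm' hr'
  exact abbp_pairsFintype d (Finset (Fin d)) (Finset (Fin d)) r r' ρ ρ' w w' h1 h1' hρi hρi'
    hcert hcert' hdec hdec' hval

end Summit.KontsevichZagierPeriods.SymplecticScissors.LogPolytope

end
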